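import Summits.CriticalPhenomena.PercolationContinuityZ3.Theorems.PercNearOneGluingNoHeavyLowerTailIncStarOneTargetSideEvents
import HarnessLib

/-!
# W-domination across a TARGET CUT, I: arithmetic core and plumbing (Sahi programme, prover prim-sahi-p2 gen 37)

Support file (`--supports stmt-CriticalPhenomena-4575`).  No definitions, no named facts, no sorries; standard axioms.  Memo
`run/shared/lean/prim/prim-sahi/FROM-prim-sahi-p2-gen37-TARGET-CUT-PKB.md` §1, `prim-sahi-p2/PROOF-E3.md` §47.  Part II
(`…IncStarWDOMTargetCut`) proves THEOREM K (`wdom_targetCut`) from the two-cut dictionary; this part has the real-arithmetic core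
`targetCut_core` — with far-type masses `α, β₁, β₂`, separator probability `ζ`, reference probability `ℓ` and the three cell bounds,
`(2 − q_i − q_j − EW)P_both − (q_j + EW)P_io − (q_i + EW)P_jo ≥ ℓ·EW·(1 − α − β₁ − β₂) ≥ 0` — and two measure lemmas.
-/

noncomputable section

namespace Summit.CriticalPhenomena.PercolationContinuityZ3.Theorems

namespace IncStar

open MeasureTheory Set Literature.Probability.Percolation Literature.Probability.LatticeModels
open scoped Classical

variable {n : ℕ}

/-- **Arithmetic core of Theorem K.**  With the far-type masses `α = P(Xu ∩ Xv)`, `β₁ = P(Xu ∖ Xv)`, `β₂ = P(Xv ∖ Xu)`, the separator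
probability `ζ = P(i ↔ j in Rᶜ)`, the reference probability `ℓ`, and the three cell bounds `P_both ≥ (α + (β₁+β₂)ζ)ℓ`, `P_io ≤ β₁(1−ζ)ℓ`,
`P_jo ≤ β₂(1−ζ)ℓ`:  `(2 − q_i − q_j − EW)P_both − (q_j + EW)P_io − (q_i + EW)P_jo ≥ ℓ·EW·(1 − α − β₁ − β₂) ≥ 0`. [this work] -/
theorem targetCut_core {α β₁ β₂ ζ ℓ Pb Pio Pjo qi qj qij EW : ℝ}
    (hα : 0 ≤ α) (hβ₁ : 0 ≤ β₁) (hβ₂ : 0 ≤ β₂) (hsum : α + β₁ + β₂ ≤ 1) (hζ0 : 0 ≤ ζ) (hζ1 : ζ ≤ 1) (hℓ : 0 ≤ ℓ)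
    (hqi : qi = α + β₁ + β₂ * ζ) (hqj : qj = α + β₂ + β₁ * ζ) (hqij : qij = α + (β₁ + β₂) * ζ)
    (hEW : EW = 2 * qij - 2 * (qi * qj)) (hEW0 : 0 ≤ EW)
    (hPb : (α + (β₁ + β₂) * ζ) * ℓ ≤ Pb) (hPio : Pio ≤ β₁ * (1 - ζ) * ℓ) (hPjo : Pjo ≤ β₂ * (1 - ζ) * ℓ) :
    0 ≤ (2 - qi - qj - EW) * Pb - (qj + EW) * Pio - (qi + EW) * Pjo := by
  have hqi0 : 0 ≤ qi := by rw [hqi]; positivity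
  have hqj0 : 0 ≤ qj := by rw [hqj]; positivity
  have hqi1 : qi ≤ 1 := by rw [hqi]; nlinarith
  have hqj1 : qj ≤ 1 := by rw [hqj]; nlinarith
  have hdi : 0 ≤ qi - qij := by rw [hqi, hqij]; nlinarith
  have hdj : 0 ≤ qj - qij := by rw [hqj, hqij]; nlinarith
  have hc : 0 ≤ 2 - qi - qj - EW := by
    have : 2 - qi - qj - EW = 2 * ((1 - qi) * (1 - qj)) + (qi - qij) + (qj - qij) := by rw [hEW]; ring
    rw [this]
    have : 0 ≤ (1 - qi) * (1 - qj) := mul_nonneg (by linarith) (by linarith)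
    linarith
  have h1 : (2 - qi - qj - EW) * ((α + (β₁ + β₂) * ζ) * ℓ) ≤ (2 - qi - qj - EW) * Pb := mul_le_mul_of_nonneg_left hPb hc
  have h2 : (qj + EW) * Pio ≤ (qj + EW) * (β₁ * (1 - ζ) * ℓ) := mul_le_mul_of_nonneg_left hPio (by linarith)
  have h3 : (qi + EW) * Pjo ≤ (qi + EW) * (β₂ * (1 - ζ) * ℓ) := mul_le_mul_of_nonneg_left hPjo (by linarith)
  have key : (2 - qi - qj - EW) * ((α + (β₁ + β₂) * ζ) * ℓ) - (qj + EW) * (β₁ * (1 - ζ) * ℓ) - (qi + EW) * (β₂ * (1 - ζ) * ℓ)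
      = ℓ * EW * (1 - α - β₁ - β₂) := by
    rw [hEW, hqi, hqj, hqij]; ring
  have hpos : 0 ≤ ℓ * EW * (1 - α - β₁ - β₂) := mul_nonneg (mul_nonneg hℓ hEW0) (by linarith)
  linarith

/-- Harris with one decreasing event: `P(A ∩ Bᶜ) ≤ P(A)·(1 − P(B))` for increasing `A, B` (plumbing). [folklore] -/
theorem real_inter_compl_le_of_upper (w : Sym2 (Fin n) → unitInterval) {A B : Set (BondConfig (Fin n))}
    (hA : IsUpperSet A) (hB : IsUpperSet B) :
    (prodBernoulli w).real (A ∩ Bᶜ) ≤ (prodBernoulli w).real A * (1 - (prodBernoulli w).real B) := by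
  have hm : ∀ X : Set (BondConfig (Fin n)), MeasurableSet X := fun _ => MeasurableSet.of_discrete
  have h := prodBernoulli_harris w hA hB (hm A) (hm B)
  have hsplit : (prodBernoulli w).real (A ∩ B) + (prodBernoulli w).real (A \ B) = (prodBernoulli w).real A :=
    measureReal_inter_add_sdiff (hm B)
  have hAB : A ∩ Bᶜ = A \ B := rfl
  rw [hAB]
  nlinarith [hsplit]

/-- `P(X) = P(X ∩ Y) + P(X ∩ Yᶜ)` (plumbing). [folklore] -/
theorem real_split (w : Sym2 (Fin n) → unitInterval) (X Y : Set (BondConfig (Fin n))) :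
    (prodBernoulli w).real X = (prodBernoulli w).real (X ∩ Y) + (prodBernoulli w).real (X ∩ Yᶜ) := by
  have hXY : X ∩ Yᶜ = X \ Y := rfl
  rw [hXY]
  exact (measureReal_inter_add_sdiff (μ := prodBernoulli w) (s := X) (t := Y) MeasurableSet.of_discrete).symm

end IncStar

end Summit.CriticalPhenomena.PercolationContinuityZ3.Theorems
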